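import Summits.ABC.IUTFork.Cor312GenuineKWildLowerBound
import HarnessLib

/-!
# [IUTchIII] Cor. 3.12, branch C / R-W window table — the TWIST factor `2` of the lower local type at the `K`-level pilot
# datum, in its honest kernel form: `√y ∈ F` with `ord_p(y)` odd ⟹ `2 ∣ e(K_{x₀}/ℚ_p)` at every fibre point `x₀ ∣ p`

PROOF-ONLY support file (D-0012; 0 definitions, 0 `Prop` facts) of the abc-iut cell (R-W «WINDOW Θ-SIDE INEQUALITY», seat
abc-iut-W-neg-2 gen 2, row «W:LOCAL-TYPE-LB-FIBRE», input «LBt» of the numerics lead's inhabited-side route census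
HOME/plan/rescue/R-W/OPEN-INHABITED-ROUTE.tsv). TAKES NO SIDE on [IUTchIII] Cor. 3.12 (S. Mochizuki, *Inter-universal
Teichmüller theory III*, RIMS manuscript, Cor. 3.12 p. 173–174) or on any author.

THE POINT, AND ITS HONEST SCOPE. In the cell's MODEL READING v3 of [IUTchIV] Thm. 1.10 (p. 22: "`E_F`" IS the Legendre
curve `y² = x(x−1)(x−λ)` and `F = F‡(P) = F_tpd(√−1, √λ, √(λ−1), E_λ[3·5])`), the field `F` contains `√λ` and `√(λ−1)`, so
at a place `w` of `F` over a prime `p` at which `ord_p(λ)` (resp. `ord_p(λ−1)`) is ODD the ramification index `e(w | p)` is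
EVEN (`ord_w(λ) = e(w|p)·ord_p(λ) = 2·ord_w(√λ)`): this is the «twist factor `2`» of the R-W numerics (e.g. at `p ∣ c` with
`v_p(c)` odd for `λ = a/c`). The TYPED datum `Cor22.ThetaVolumeDatumAt (ratPoint λ) l`, however, pins `E_F` only through
`j(E_F) = j(λ)` and `F` only through `F ⊆ F‡(P)` (`IsSubThetaField`), so it admits quadratic twists of the Legendre model over
fields NOT containing `√λ`; the factor `2` is therefore NOT a theorem about the typed datum alone. This file states it with
the model clause as an EXPLICIT hypothesis `IsSquare (algebraMap F_tpd F y)` (`√y ∈ F`), for any `y ∈ ℚ` of odd order at `p`: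

* `Conditional.GenuineK.two_dvd_ramificationIdx_F_of_isSquare` — `√y ∈ F`, `ord_p(y)` odd: **`2 ∣ e(w | p)`** for every
  place `w ∣ p` of `F`;
* `Conditional.GenuineK.two_dvd_absRamificationIdx_kOf_of_isSquare` — fibre form: **`2 ∣ e(K_{x₀}/ℚ_p)`** at EVERY fibre
  point `x₀ ∣ p` of `pilotDataOfK T.D T.K` (any prime `p`, no pole hypothesis);
* `Conditional.GenuineK.two_mul_prime_dvd_absRamificationIdx_kOf_of_isSquare` — at a rational pole of `j`, `p ∉ {2, l}`:
  **`2·l ∣ e(K_{x₀}/ℚ_p)`** (with abc-iut-W-neg-1's exact factor `l`, p467688);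
* `Conditional.GenuineK.thirty_mul_prime_dvd_absRamificationIdx_kOf_mul_of_isSquare` — with the Tate root (abc-iut-W-neg-1's
  `15·l ∣ e·t`, p467688): `ord_p j(λ) = −2t` ⟹ **`30·l ∣ e(K_{x₀}/ℚ_p)·t`**, i.e. `lcm(2, 15/gcd(15,t))·l ∣ e` — the numerics
  lead's level-2 tame bound «LBv + LBt».

Consumers (abc-iut-W-row-1/2) discharge the hypothesis from their model clause (`F = F‡(P)`), or carry it; the refuted
side never needs it. HONEST FRAMING: bookkeeping over OUR typed objects; nothing here bears on the printed inequality of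
[IUTchIII] Cor. 3.12 or on the number-level `Cor22.Cor312AtDatum`; typed ≠ proved; instantiated ≠ endorsed.
[cite: Mochizuki2012, IUTchIV Thm. 1.10 p. 22, Cor. 2.2 (ii) proof (P5) p. 46; IUTchI Ex. 3.2 (iv) p. 71]
[cite: NeukirchANT1999, Ch. II Prop. (6.8)] [cite: SilvermanATAEC1994, V.5 Thm. 5.3 and Cor. 5.4]
[claim: Mochizuki2012, status: disputed] for every IUT quotation.
-/

noncomputable section

open NumberField IsDedekindDomain

namespace Summit.ABC.IUTFork.Conditional

open Thm311 Thm311.Real Cor312 Cor312Prov Literature.IUT.LogVolume Literature.IUT.HodgeTheaters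
  Literature.IUT.LogThetaLattice Literature.NumberTheory.NumberFields Literature.NumberTheory.DiophantineGeometry.GenEll
  Literature.NumberTheory.DiophantineGeometry

/-- **`√y ∈ F` and `ord_p(y)` odd ⟹ `2 ∣ e(w | p)` for every place `w ∣ p` of the field `F` of a genuine Θ-volume datum over a
rational point**: `ord_w(y) = e(w | p)·ord_p(y)` (Neukirch II (6.8), the tree's `Cor22.ord_algebraMap_eq`) and `ord_w(y) = 2·ord_w(√y)`.
The hypothesis `IsSquare (algebraMap F_tpd F y)` is the MODEL clause (`F = F‡(P) ∋ √λ, √(λ−1)`); it does not follow from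
`IsSubThetaField`. [cite: NeukirchANT1999, Ch. II Prop. (6.8)] [cite: Mochizuki2012, IUTchIV Thm. 1.10 p. 22] [claim: Mochizuki2012, status: disputed] -/
theorem GenuineK.two_dvd_ramificationIdx_F_of_isSquare {q : ℚ} {l : ℕ} (T : Cor22.ThetaVolumeDatumAt (ratPoint q) l)
    (pp : Nat.Primes) {y : ℚ} (hsq : letI := T.instFieldF; letI := T.instAlgebraF; IsSquare (algebraMap (ratPoint q).F T.F y))
    (hodd : ∀ v : HeightOneSpectrum (𝓞 ℚ), Rat.HeightOneSpectrum.natGenerator v = pp → Odd (Literature.IUT.LogVolume.ord ℚ v y))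
    (w : letI := T.instFieldF; letI := T.instNumberFieldF; HeightOneSpectrum (𝓞 T.F))
    (hw : letI := T.instFieldF; letI := T.instNumberFieldF; ((pp : ℕ) : 𝓞 T.F) ∈ w.asIdeal) :
    2 ∣ (letI := T.instFieldF; letI := T.instNumberFieldF; w.asIdeal.ramificationIdx ℤ) := by
  letI := T.instFieldF; letI := T.instNumberFieldF; letI := T.instAlgebraF
  haveI : Fact (pp : ℕ).Prime := ⟨pp.2⟩
  -- the place of `ℚ` under `w` is `p`
  set v : HeightOneSpectrum (𝓞 ℚ) := finBelow (ratPoint q).F T.F w with hvdef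
  have hwchar : residueChar T.F w = (pp : ℕ) := residueChar_eq_of_natCast_mem pp.1 hw
  have hvp : Rat.HeightOneSpectrum.natGenerator v = pp := by
    have hchar : residueChar ℚ v = pp := by
      rw [hvdef]
      change residueChar (ratPoint q).F (finBelow (ratPoint q).F T.F w) = pp
      rw [residueChar_finBelow, hwchar]
    have hmem : ((pp : ℕ) : 𝓞 ℚ) ∈ v.asIdeal := by
      rw [Cor22.natCast_mem_asIdeal_iff_residueChar_eq v pp.2]; exact hchar
    have hdvd := (UniformABCConjecture.natCast_mem_asIdeal_iff v pp).1 hmem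
    exact (Nat.prime_dvd_prime_iff_eq (Rat.HeightOneSpectrum.prime_natGenerator v) pp.2).1 hdvd
  -- `ord_w(y) = e(w|v)·ord_v(y) = 2·ord_w(s)` with `y = s²` in `F`
  obtain ⟨s, hs⟩ := hsq
  have h1 := Cor22.ord_algebraMap_eq (F := (ratPoint q).F) (K := T.F) w y
  have h2 : Literature.IUT.LogVolume.ord T.F w (algebraMap (ratPoint q).F T.F y) = 2 * Literature.IUT.LogVolume.ord T.F w s := by
    rw [hs, ← pow_two, ord_pow]; push_cast; ring
  have hodd' : Odd (Literature.IUT.LogVolume.ord ℚ v y) := hodd v hvp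
  -- hence `e(w|v)` is even
  have heven : Even (((finBelow (ratPoint q).F T.F w).asIdeal.ramificationIdx' w.asIdeal : ℤ)) := by
    have hprod : Even ((((finBelow (ratPoint q).F T.F w).asIdeal.ramificationIdx' w.asIdeal : ℕ) : ℤ) *
        Literature.IUT.LogVolume.ord ℚ v y) := by
      change Even ((((finBelow (ratPoint q).F T.F w).asIdeal.ramificationIdx' w.asIdeal : ℕ) : ℤ) *
        Literature.IUT.LogVolume.ord (ratPoint q).F (finBelow (ratPoint q).F T.F w) y)
      rw [← h1, h2]; exact even_two_mul _
    rcases Int.even_mul.mp hprod with he | he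
    · exact he
    · exact absurd he (Int.not_even_iff_odd.mpr hodd')
  have heven' : 2 ∣ (finBelow (ratPoint q).F T.F w).asIdeal.ramificationIdx' w.asIdeal := by
    have := even_iff_two_dvd.mp heven
    exact_mod_cast this
  -- `e(w | p) = e(w | v)` over `ℚ`
  have hew : w.asIdeal.ramificationIdx ℤ = (finBelow (ratPoint q).F T.F w).asIdeal.ramificationIdx' w.asIdeal := by
    have h1' : ramIdx (ratPoint q).F (w.under (𝓞 (ratPoint q).F)) = 1 := by
      rw [ramIdx_eq]
      exact Literature.NumberTheory.EllipticCurves.Fisher2016.ramificationIdx_int_rat_eq_one _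
    rw [ThetaData.absRamificationIdx_eq_ramIdx_mul (F := (ratPoint q).F) w]
    erw [h1', one_mul]
    rfl
  rw [hew]; exact heven'

/-- **Fibre form: `√y ∈ F` and `ord_p(y)` odd ⟹ `2 ∣ e(K_{x₀}/ℚ_p)` at EVERY fibre point `x₀ ∣ p` of the `K`-level pilot
datum** (any prime `p`, no pole hypothesis): `e(K_{x₀}/ℚ_p) = e(w | p)·e(x₀ | w)` with `w = x₀ ∩ 𝓞_F`. The twist factor `2`
of the R-W numerics in the model reading (`y = λ` at `p ∣ a·c`, `y = λ − 1` at `p ∣ b`, `F = F‡(P)`).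
[cite: NeukirchANT1999, Ch. II Prop. (6.8)] [cite: Mochizuki2012, IUTchIV Thm. 1.10 p. 22] [claim: Mochizuki2012, status: disputed] -/
theorem GenuineK.two_dvd_absRamificationIdx_kOf_of_isSquare {q : ℚ} {l : ℕ} (T : Cor22.ThetaVolumeDatumAt (ratPoint q) l)
    (pp : Nat.Primes) {y : ℚ} (hsq : letI := T.instFieldF; letI := T.instAlgebraF; IsSquare (algebraMap (ratPoint q).F T.F y))
    (hodd : ∀ v : HeightOneSpectrum (𝓞 ℚ), Rat.HeightOneSpectrum.natGenerator v = pp → Odd (Literature.IUT.LogVolume.ord ℚ v y)) :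
    letI := T.instFieldF; letI := T.instNumberFieldF; letI := T.instAlgebraF; letI := T.instFieldK
    letI := T.instNumberFieldK; letI := T.instAlgebraK; letI := T.instFieldFbar; letI := T.instAlgebraFbar
    letI := T.instAlgebraKFbar; letI := T.instIsElliptic
    haveI : Fact (pp : ℕ).Prime := ⟨pp.2⟩
    ∀ x₀ : (thetaIndex (pilotDataOfK T.D T.K)).Fibre (.inr pp),
      2 ∣ absRamificationIdx (pp : ℕ) (kOf (pilotDataOfK T.D T.K) pp.1 x₀) := by
  letI := T.instFieldF; letI := T.instNumberFieldF; letI := T.instAlgebraF; letI := T.instFieldK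
  letI := T.instNumberFieldK; letI := T.instAlgebraK; letI := T.instFieldFbar; letI := T.instAlgebraFbar
  letI := T.instAlgebraKFbar; letI := T.instIsElliptic
  haveI : Fact (pp : ℕ).Prime := ⟨pp.2⟩
  set X := pilotDataOfK T.D T.K with hXdef
  intro x₀
  set u := placeOf X pp.1 x₀ with hudef
  have hpu : ((pp : ℕ) : 𝓞 T.K) ∈ u.asIdeal := natCast_mem_placeOf X pp.1 x₀
  have hekOf : absRamificationIdx (pp : ℕ) (kOf X pp.1 x₀) = u.asIdeal.ramificationIdx ℤ := by
    rw [show absRamificationIdx (pp : ℕ) (kOf X pp.1 x₀) =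
        absRamificationIdx (pp : ℕ) (RescaledCompletion T.K pp.1 (placeOf X pp.1 x₀) hpu) from rfl,
      absRamificationIdx_rescaledCompletion]
  have hpw : ((pp : ℕ) : 𝓞 T.F) ∈ (finBelow T.F T.K u).asIdeal := by
    change ((pp : ℕ) : 𝓞 T.F) ∈ Ideal.comap (algebraMap (𝓞 T.F) (𝓞 T.K)) u.asIdeal
    rw [Ideal.mem_comap, map_natCast]
    exact hpu
  have hF : 2 ∣ (finBelow T.F T.K u).asIdeal.ramificationIdx ℤ :=
    GenuineK.two_dvd_ramificationIdx_F_of_isSquare T pp hsq hodd (finBelow T.F T.K u) hpw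
  rw [hekOf, ThetaData.absRamificationIdx_eq_ramIdx_mul (F := T.F) u, ramIdx_eq]
  exact dvd_mul_of_dvd_left hF _

/-- **`2·l ∣ e(K_{x₀}/ℚ_p)` at every fibre point over a rational pole of `j`, `p ∉ {2, l}`, when `√y ∈ F` with `ord_p(y)` odd**:
the twist factor `2` of `e(w | p)` times the exact `l` of the `l`-division layer (abc-iut-W-neg-1's
`GenuineK.absRamificationIdx_kOf_eq_mul_prime_ratPoint`). [cite: Mochizuki2012, IUTchI Ex. 3.2 (iv) p. 71] [claim: Mochizuki2012, status: disputed] -/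
theorem GenuineK.two_mul_prime_dvd_absRamificationIdx_kOf_of_isSquare {q : ℚ} {l : ℕ}
    (T : Cor22.ThetaVolumeDatumAt (ratPoint q) l) (pp : Nat.Primes) (hp2 : (pp : ℕ) ≠ 2) (hpl : (pp : ℕ) ≠ l)
    (hpole : ∀ v : HeightOneSpectrum (𝓞 ℚ), Rat.HeightOneSpectrum.natGenerator v = pp →
      Literature.IUT.LogVolume.ord ℚ v (Cor22.jInv q) < 0)
    {y : ℚ} (hsq : letI := T.instFieldF; letI := T.instAlgebraF; IsSquare (algebraMap (ratPoint q).F T.F y))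
    (hodd : ∀ v : HeightOneSpectrum (𝓞 ℚ), Rat.HeightOneSpectrum.natGenerator v = pp → Odd (Literature.IUT.LogVolume.ord ℚ v y)) :
    letI := T.instFieldF; letI := T.instNumberFieldF; letI := T.instAlgebraF; letI := T.instFieldK
    letI := T.instNumberFieldK; letI := T.instAlgebraK; letI := T.instFieldFbar; letI := T.instAlgebraFbar
    letI := T.instAlgebraKFbar; letI := T.instIsElliptic
    haveI : Fact (pp : ℕ).Prime := ⟨pp.2⟩
    ∀ x₀ : (thetaIndex (pilotDataOfK T.D T.K)).Fibre (.inr pp),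
      2 * l ∣ absRamificationIdx (pp : ℕ) (kOf (pilotDataOfK T.D T.K) pp.1 x₀) := by
  letI := T.instFieldF; letI := T.instNumberFieldF; letI := T.instAlgebraF; letI := T.instFieldK
  letI := T.instNumberFieldK; letI := T.instAlgebraK; letI := T.instFieldFbar; letI := T.instAlgebraFbar
  letI := T.instAlgebraKFbar; letI := T.instIsElliptic
  haveI : Fact (pp : ℕ).Prime := ⟨pp.2⟩
  set X := pilotDataOfK T.D T.K with hXdef
  intro x₀
  rw [GenuineK.absRamificationIdx_kOf_eq_mul_prime_ratPoint T pp hp2 hpl hpole x₀]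
  set u := placeOf X pp.1 x₀ with hudef
  have hpu : ((pp : ℕ) : 𝓞 T.K) ∈ u.asIdeal := natCast_mem_placeOf X pp.1 x₀
  have hpw : ((pp : ℕ) : 𝓞 T.F) ∈ (finBelow T.F T.K u).asIdeal := by
    change ((pp : ℕ) : 𝓞 T.F) ∈ Ideal.comap (algebraMap (𝓞 T.F) (𝓞 T.K)) u.asIdeal
    rw [Ideal.mem_comap, map_natCast]
    exact hpu
  exact mul_dvd_mul (GenuineK.two_dvd_ramificationIdx_F_of_isSquare T pp hsq hodd (finBelow T.F T.K u) hpw) dvd_rfl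

/-- Arithmetic glue: `l ∣ e`, `2·l ∣ e` and `15·l ∣ e·t` give `30·l ∣ e·t`. [folklore] -/
private theorem thirty_mul_dvd_of_dvd {l e t : ℕ} (hl : 0 < l) (hle : l ∣ e) (h2 : 2 * l ∣ e)
    (h15 : 15 * l ∣ e * t) : 30 * l ∣ e * t := by
  obtain ⟨e₁, rfl⟩ := hle
  have h2' : 2 ∣ e₁ := by
    have : l * 2 ∣ l * e₁ := by rw [mul_comm l 2]; exact h2
    exact Nat.dvd_of_mul_dvd_mul_left hl this
  have h15' : 15 ∣ e₁ * t := by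
    have : l * 15 ∣ l * (e₁ * t) := by rw [mul_comm l 15, ← mul_assoc]; exact h15
    exact Nat.dvd_of_mul_dvd_mul_left hl this
  have h : 2 * 15 ∣ e₁ * t := (by norm_num : Nat.Coprime 2 15).mul_dvd_of_dvd_of_dvd (dvd_mul_of_dvd_left h2' t) h15'
  rw [show 30 * l = l * (2 * 15) by ring, show l * e₁ * t = l * (e₁ * t) by ring]
  exact mul_dvd_mul_left l h

/-- **`30·l ∣ e(K_{x₀}/ℚ_p)·t` at every fibre point over a rational pole of `j` of order `2t`, `p ∉ {2, l}` (also `p ∈ {3,5}`),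
when `√y ∈ F` with `ord_p(y)` odd**: the Tate-root factor `15/gcd(15,t)` (abc-iut-W-neg-1's
`GenuineK.fifteen_mul_prime_dvd_absRamificationIdx_kOf_mul_ratPoint`), the twist factor `2` and the exact `l` — the R-W
numerics lead's tame level-2 lower bound «LBv + LBt» `lcm(15/gcd(15,t), 2)·l ∣ e` in the model reading.
[cite: SilvermanATAEC1994, V.5 Thm. 5.3 and Cor. 5.4] [cite: Mochizuki2012, IUTchIV Thm. 1.10 p. 22] [claim: Mochizuki2012, status: disputed] -/
theorem GenuineK.thirty_mul_prime_dvd_absRamificationIdx_kOf_mul_of_isSquare {q : ℚ} {l : ℕ}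
    (T : Cor22.ThetaVolumeDatumAt (ratPoint q) l) (pp : Nat.Primes) (hp2 : (pp : ℕ) ≠ 2) (hpl : (pp : ℕ) ≠ l)
    {t : ℕ} (ht : 0 < t)
    (hpole : ∀ v : HeightOneSpectrum (𝓞 ℚ), Rat.HeightOneSpectrum.natGenerator v = pp →
      Literature.IUT.LogVolume.ord ℚ v (Cor22.jInv q) = -(2 * (t : ℤ)))
    {y : ℚ} (hsq : letI := T.instFieldF; letI := T.instAlgebraF; IsSquare (algebraMap (ratPoint q).F T.F y))
    (hodd : ∀ v : HeightOneSpectrum (𝓞 ℚ), Rat.HeightOneSpectrum.natGenerator v = pp → Odd (Literature.IUT.LogVolume.ord ℚ v y)) :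
    letI := T.instFieldF; letI := T.instNumberFieldF; letI := T.instAlgebraF; letI := T.instFieldK
    letI := T.instNumberFieldK; letI := T.instAlgebraK; letI := T.instFieldFbar; letI := T.instAlgebraFbar
    letI := T.instAlgebraKFbar; letI := T.instIsElliptic
    haveI : Fact (pp : ℕ).Prime := ⟨pp.2⟩
    ∀ x₀ : (thetaIndex (pilotDataOfK T.D T.K)).Fibre (.inr pp),
      30 * l ∣ absRamificationIdx (pp : ℕ) (kOf (pilotDataOfK T.D T.K) pp.1 x₀) * t := by
  letI := T.instFieldF; letI := T.instNumberFieldF; letI := T.instAlgebraF; letI := T.instFieldK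
  letI := T.instNumberFieldK; letI := T.instAlgebraK; letI := T.instFieldFbar; letI := T.instAlgebraFbar
  letI := T.instAlgebraKFbar; letI := T.instIsElliptic
  haveI : Fact (pp : ℕ).Prime := ⟨pp.2⟩
  intro x₀
  have hpole' : ∀ v : HeightOneSpectrum (𝓞 ℚ), Rat.HeightOneSpectrum.natGenerator v = pp →
      Literature.IUT.LogVolume.ord ℚ v (Cor22.jInv q) < 0 := fun v hv => by
    rw [hpole v hv]
    have : (0 : ℤ) < t := by exact_mod_cast ht
    linarith
  have hle := GenuineK.prime_dvd_absRamificationIdx_kOf_ratPoint T pp hp2 hpl hpole' x₀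
  have h2 := GenuineK.two_mul_prime_dvd_absRamificationIdx_kOf_of_isSquare T pp hp2 hpl hpole' hsq hodd x₀
  have h15 := GenuineK.fifteen_mul_prime_dvd_absRamificationIdx_kOf_mul_ratPoint T pp hp2 hpl ht hpole x₀
  exact thirty_mul_dvd_of_dvd T.D.l_prime.pos hle h2 h15

end Summit.ABC.IUTFork.Conditional

end
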